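import Literature.Probability.Percolation.SlabGluingLemma6
import Literature.Probability.Percolation.SlabGluingFact2ConnectorAt
import HarnessLib

/-!
# DST 2016, §2.3, Fact 2 discharged in the full range: `DuminilCopinSidoraviciusTassion2016_fact2_holds`

Topic: `Literature/Probability/Percolation`. The proofs file of `SlabGluing.lean`: its last named
fact, `DuminilCopinSidoraviciusTassion2016_fact2` (Duminil-Copin–Sidoravicius–Tassion 2016, §2.3,
Fact 2, as printed: "Fix `ε > 0`. For `t` large enough,
`P[𝒳 ∩ {|U| ≥ t}] ≤ ε · P[S_{3n} ⟷^{B_{3n} ∪ B'_n} S'_n]`", `t = t(k, p, ε)` uniform over the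
geometric data in the range of Lemma 6: `n ≥ 2`, `u_{3n} ≤ n`, `3 u_n ≤ n`, `1 ≤ α_n ≤ n - 1`,
`0 ≤ y ≤ 3n`), is DISCHARGED here (`DuminilCopinSidoraviciusTassion2016_fact2_holds`).

The tree reduces the fact to hypothesis (H1) of `SlabGluingFact2Reduction.lean` — for every lattice
configuration `ω ∈ 𝒳`, recoverable located surgeries `GlueGeom.SurgOut` exist at all but boundedly
many points of `U(ω)` (`GlueGeom.real_evX_ncard_le`, Lemma 7 for a `7`-separated subfamily, and
`…_fact2_bound_of_rate`) — and proves (H1) in the range `u_{3n} + 1 ≤ n`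
(`GlueGeom.exists_good_family`: DST's rerouting surgery in the cleared box `D(z)`,
`SlabGluingRouting.lean`). In the boundary case `u_{3n} = n` the box `S̄_{3n} = B̄_n` meets `B̄'_n` in
the column `x = n`, a case on which the printed proof (pp. 6–7 of arXiv:1401.7130) is silent;
`SlabGluingLemma6.lean` treats it for the smaller set `U'(ω)` (lattice-neighbour witnesses) — the
graft over `S_{3n}`, the clipped cleared box `D^c(z)` elsewhere — which suffices for Lemma 6 but not
for Fact 2 as stated, over `U(ω)` (sup-norm witnesses, (P2) of the paper). This file proves (H1) over
`U(ω)` in the full range, with the same excluded bounded sets (`zBad ∪ lastBad ∪ srcCorner`, at most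
`105` points):

* `GlueGeom.exists_connector_of_corridor_at` — PROVED: the connector surgery of
  `SlabGluingFact2Connector.lean` built from a lattice corridor attached at an ARBITRARY vertex `g` of
  `γ_min(ω)` (the tree's `GlueGeom.exists_connector_of_corridor` is the case of the last vertex),
  under DST's order condition "`(z,v) ≺ (z,w)`" on the first corridor vertex.
* `GlueGeom.exists_surgOut_src` — PROVED: a located surgery at every point `z = (n, z₂)` of `U(ω)`
  over `S_{3n}` (off `lastBad`, `srcCorner`). Its witness starts over the column `x = n + 1` within
  one row (a start over `S_{3n}` would give `C`). If the right-hand neighbour `a = z + (1,0)` is a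
  column of `γ_min(ω)`: the rerouting surgery with the cleared box `[n+1, n+3] × [z₂-3, z₂+3]`, off
  `S̄_{3n}` and inside `z + B_3`, through which `γ_min` passes over `a`
  (`GlueGeom.exists_surgOut_src_box`, by `GlueGeom.exists_surgery_rect` of
  `SlabGluingFact2Boxes.lean`). If `a` is off `γ_min(ω)` and the witness starts over `a`: `z ∈ U'(ω)`
  and the graft applies (`GlueGeom.exists_surgOut_of_goodU'`, `SlabGluingLemma6.lean`). If `a` is off
  `γ_min(ω)` and the witness starts over a diagonal column `d = (n+1, z₂ ± 1)`: the connector attached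
  at the last vertex `g` of `γ_min(ω)` over `z`, along the column over `a` from the height of `g` to
  that of the last witness vertex `w'` over `d`, then `w'` (`GlueGeom.exists_surgOut_src_corridor`);
  the order condition holds since the successor of `g` is a lattice neighbour of `g` at the same
  height over a column of `γ_min(ω)` other than those of `z` and `a`, hence to the left of `a`.
* `GlueGeom.exists_surgOut_cDbox_U` — PROVED: off `S_{3n}` the clipped box `D^c(z)` of
  `SlabGluingLemma6.lean` contains the sup-norm witness start as well
  (`GlueGeom.mem_cDbox_of_sqBox_one`), so its rectangle surgery applies to the points of `U(ω)`.
* `GlueGeom.exists_goodUfull_family`, `fact2_rate_full` — PROVED: (H1) with `N₀ = 105`, whence the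
  rate form `P[𝒳 ∩ {|U| ≥ t}] ≤ (338 λ^{169(5k+4)}/t) P[C]` for `t ≥ 210` in the full range
  (`λ = 2/min{p, 1-p}`), and `DuminilCopinSidoraviciusTassion2016_fact2_holds`.

## Sources

* H. Duminil-Copin, V. Sidoravicius, V. Tassion, *Absence of infinite cluster for critical
  Bernoulli percolation on slabs*, Comm. Pure Appl. Math. 69 (2016), no. 7, 1397–1411,
  arXiv:1401.7130: §2.3, Lemma 7 (p. 6), Definition of `γ_min` and `U(ω)` (P1)–(P2) (p. 6), Fact 2
  and its proof (pp. 6–7: the construction of `ω^{(z)}`, the order condition `(z,v) ≺ (z,w)`, the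
  recovery of `z`, the display `P[𝒳 ∩ {|U| > t}] ≤ ((2/min{p,1-p})^C / t) P[S_{3n} ⟷ S'_n]` and
  "Choosing `t` large enough concludes the proof"). Pages are those of the arXiv text
  (`lit read arxiv:1401.7130`).
* C. M. Newman, V. Tassion, W. Wu, *Critical percolation and the minimal spanning tree in slabs*,
  Comm. Pure Appl. Math. 70 (2017), 2084–2120, §3.2 (the vertex-lexicographic order; proof of
  Thm. 3.9, Fact 2) [NewmanTassionWu2017] — through the files imported.

## Design choices

* Only the interface `GlueGeom.SurgOut` (radius `3`) of `SlabGluingFact2Reduction.lean` is produced;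
  the Lemma 7 bookkeeping and the passage from the rate form to the printed statement are the tree's
  (`GlueGeom.real_evX_ncard_le`, `DuminilCopinSidoraviciusTassion2016_fact2_bound_of_rate`).
* The points over `S_{3n}` are attributed their own surgeries (no re-pointing to a neighbouring
  point of `U'(ω)`), so the attachment statistic stays over `z + B_3` and the counting of
  `SlabGluingLemma6.lean` (`105` excluded points, `t ≥ 210`, `K = 338 λ^{169(5k+4)}`) is unchanged.
* No statement of `SlabGluing.lean` is modified and no named fact is introduced.
-/

noncomputable section

namespace Literature.Probability.Percolation

open _root_.MeasureTheory LatticeModels SimpleGraph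

namespace GlueGeom

variable {k : ℕ} {G : GlueGeom} {ω : BondConfig (slab 3 k)}

/-! ## A connector from a corridor attached inside `γ_min` -/

/-- PROVED — **a connector from a corridor meeting a witness path, attached at a vertex `g` of
`γ_min(ω)`** (the general form of `GlueGeom.exists_connector_of_corridor`, which is the case of the
last vertex): for `ω ∈ 𝒳` a lattice configuration, a non-empty lattice corridor `C` with `g :: C` a
self-avoiding lattice chain, `C` off `γ_min(ω)`, inside `\overline{B_{3n} ∪ B'_n}`, off `S̄_{3n}` and
off `S̄'_n`, whose first vertex beats the successor of `g` on `γ_min(ω)` for the key order (DST's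
condition "`(z,v) ≺ (z,w)`"), and which meets an `ω`-open self-avoiding path `π` to `S̄'_n` inside
`B̄'_n` off the columns of `γ_min(ω)`, yields connector data attached at `g` with interior in `C`.
[cite: DuminilCopinSidoraviciusTassion2016, §2.3, proof of Fact 2 (pp. 6–7)] -/
theorem exists_connector_of_corridor_at (hω : ω ⊆ (slabGraph 3 k).edgeSet) (hX : ω ∈ G.evX k)
    {g : slab 3 k} (hg : g ∈ G.γmin k ω) {C : List (slab 3 k)} (hCne : C ≠ [])
    (hchain : (g :: C).IsChain (fun a b => (slabGraph 3 k).Adj a b))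
    (hnodup : (g :: C).Nodup)
    (hCγ : ∀ x ∈ C, x ∉ G.γmin k ω) (hCreg : ∀ x ∈ C, x ∈ slabLift k (G.big ∪ G.small))
    (hCsrc : ∀ x ∈ C, x ∉ slabLift k G.src) (hCsrc' : ∀ x ∈ C, x ∉ slabLift k G.src')
    (hfwd : ∀ (l₁ l₂ : List (slab 3 k)) (y : slab 3 k), G.γmin k ω = l₁ ++ g :: y :: l₂ →
      vKey k y < vKey k (C.head hCne))
    {π : List (slab 3 k)} {x₀ s' : slab 3 k} (hs' : s' ∈ slabLift k G.src')
    (hπO : IsOSAP k ω (slabLift k G.small ∩ {v | planar k v ∉ G.γcols k ω}) {x₀} {s'} π)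
    (hmeet : ∃ x ∈ C, x ∈ π) :
    ∃ cn : G.Connector k ω, cn.g = g ∧ ∀ x ∈ cn.I, x ∈ C := by
  have hA : ω ∈ G.evA k := hX.1.1.1
  have hγO := (G.γmin_spec k hA).1
  -- the first vertex of the corridor on `π`
  obtain ⟨C₁, v, C₂, rfl, hvπ, hC₁π⟩ := exists_first_split (p := fun x => x ∈ π) C hmeet
  obtain ⟨πa, πb, hπeq⟩ := List.append_of_mem hvπ
  have hvC : v ∈ C₁ ++ v :: C₂ := by simp
  have hIC : ∀ x ∈ C₁ ++ [v], x ∈ C₁ ++ v :: C₂ := fun x hx => by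
    rcases List.mem_append.1 hx with h | h
    · exact List.mem_append_left _ h
    · simp only [List.mem_singleton] at h; rw [h]; exact hvC
  have hhead : ∀ h₁, (C₁ ++ [v]).head h₁ = (C₁ ++ v :: C₂).head hCne := by
    intro h₁; cases C₁ <;> rfl
  have hπnd := hπO.nodup
  have hπb : πb ≠ [] := by
    rintro rfl
    have hlast := hπO.last_mem hπO.ne_nil
    rw [Set.mem_singleton_iff] at hlast
    have : π.getLast hπO.ne_nil = v := by
      rw [List.getLast_congr _ (by simp) hπeq]; simp
    rw [this] at hlast
    exact hCsrc' v hvC (hlast ▸ hs')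
  obtain ⟨x₁, πbt, rfl⟩ := List.exists_cons_of_ne_nil hπb
  have hπOsub : ∀ x ∈ π, x ∈ slabLift k G.small ∩ {v | planar k v ∉ G.γcols k ω} := hπO.subset
  have hπγ : ∀ x ∈ π, x ∉ G.γmin k ω := fun x hx hxγ => (hπOsub x hx).2 ⟨x, hxγ, rfl⟩
  have hx₁π : x₁ ∈ π := by rw [hπeq]; simp
  have hvx₁ : v ≠ x₁ := by
    intro h
    rw [hπeq] at hπnd
    have := (List.nodup_append.1 hπnd).2.1
    rw [List.nodup_cons] at this
    exact this.1 (by rw [h]; exact List.mem_cons_self)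
  have hvπb : v ∉ x₁ :: πbt := by
    intro h
    rw [hπeq] at hπnd
    exact (List.nodup_cons.1 (List.nodup_append.1 hπnd).2.1).1 h
  -- the chain `g :: C₁ ++ [v]` and its link to `x₁`
  have hsplit : g :: (C₁ ++ v :: C₂) = (g :: (C₁ ++ [v])) ++ C₂ := by simp
  have hch1 : (g :: (C₁ ++ [v])).IsChain (fun a b => (slabGraph 3 k).Adj a b) := by
    rw [hsplit, List.isChain_append] at hchain
    exact hchain.1
  have hnd1 : (g :: (C₁ ++ [v])).Nodup := by
    rw [hsplit] at hnodup
    exact hnodup.sublist (List.sublist_append_left _ _)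
  have hlink : s(v, x₁) ∈ ω ∧ v ≠ x₁ := by
    have hch := hπO.chain
    rw [hπeq, List.isChain_append] at hch
    obtain ⟨-, h2, -⟩ := hch
    exact List.isChain_cons_cons.1 h2 |>.1
  refine ⟨⟨g, C₁ ++ [v], x₁, x₁ :: πbt, hg, by simp, ?_, ?_,
    fun x hx => hCreg x (hIC x hx), fun x hx => hCγ x (hIC x hx), ?_, fun x hx => hCsrc x (hIC x hx), ?_,
    rfl, ?_, ?_, ?_⟩, rfl, fun x hx => hIC x hx⟩
  · -- chain
    have : g :: ((C₁ ++ [v]) ++ [x₁]) = (g :: (C₁ ++ [v])) ++ [x₁] := by simp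
    rw [this]
    refine List.IsChain.append hch1 (List.isChain_singleton _) fun x hx y hy => ?_
    have hx' : x = v := by
      rw [show g :: (C₁ ++ [v]) = (g :: C₁) ++ [v] by simp, List.getLast?_concat] at hx
      simpa using hx.symm
    have hy' : y = x₁ := by simpa using hy.symm
    subst hx' hy'
    exact (SimpleGraph.mem_edgeSet _).1 (hω hlink.1)
  · -- nodup
    have : g :: ((C₁ ++ [v]) ++ [x₁]) = (g :: (C₁ ++ [v])) ++ [x₁] := by simp
    rw [this, List.nodup_append]
    refine ⟨hnd1, List.nodup_singleton _, fun a ha b hb => ?_⟩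
    rw [List.mem_singleton] at hb
    subst hb
    rintro rfl
    rcases List.mem_cons.1 ha with h | h
    · exact hπγ _ hx₁π (h ▸ hg)
    · rcases List.mem_append.1 h with h | h
      · exact hC₁π _ h hx₁π
      · simp only [List.mem_singleton] at h
        exact hvx₁ h.symm
  · -- interior off `σ = πb`
    intro x hx hxσ
    rcases List.mem_append.1 hx with h | h
    · exact hC₁π x h (by rw [hπeq]; simp [hxσ])
    · simp only [List.mem_singleton] at h
      exact hvπb (h ▸ hxσ)
  · -- the order condition, transported to the head of the interior
    intro l₁ l₂ y hγeq
    rw [hhead]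
    exact hfwd l₁ l₂ y hγeq
  · -- `σ` is `ω`-open
    have hch := hπO.chain
    rw [hπeq, List.isChain_append] at hch
    exact (List.isChain_cons.1 hch.2.1).2
  · intro x hx
    exact (hπOsub x (by rw [hπeq]; simp [hx])).1
  · intro h
    have hlast := hπO.last_mem hπO.ne_nil
    rw [Set.mem_singleton_iff] at hlast
    have : π.getLast hπO.ne_nil = (x₁ :: πbt).getLast h := by
      rw [List.getLast_congr _ (by simp) hπeq, List.getLast_append_of_ne_nil _ (List.cons_ne_nil _ _),
        List.getLast_cons_cons]
    rw [← this, hlast]; exact hs'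


/-! ## Located surgeries at the points of `U(ω)` over `S_{3n}` -/

section OverSrc

/-- Planar adjacency in coordinates. [folklore] -/
theorem planarAdj_iff_coord (z w : ℤ × ℤ) : planarAdj z w ↔
    (w.1 = z.1 + 1 ∧ w.2 = z.2) ∨ (w.1 + 1 = z.1 ∧ w.2 = z.2) ∨
      (w.1 = z.1 ∧ w.2 = z.2 + 1) ∨ (w.1 = z.1 ∧ w.2 + 1 = z.2) := by
  obtain ⟨z1, z2⟩ := z
  obtain ⟨w1, w2⟩ := w
  simp only [planarAdj, Prod.mk_add_mk, Prod.mk.injEq, add_zero]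
  omega

/-- PROVED — **the cleared box to the right of a point of `U(ω)` over `S_{3n}`.** For `ω ∈ 𝒳` a
lattice configuration and `z = (n, z₂)` with `u_{3n} = n`, `z₂ ≤ n - 1`, not within distance `3` of
the end of `γ_min(ω)`: if the right-hand neighbour column `a = z + (1,0)` is a column of `γ_min(ω)`
and a (P2)-witness starts over the column `x = n + 1` within one row of `z`, the rerouting surgery
of `SlabGluingFact2Core.lean` with the cleared box `[n+1, n+3] × [z₂-3, z₂+3] ⊆ z + B_3` (off
`S̄_{3n}`, inside `B_{3n}`, off `Z_n`; `γ_min` passes over `a`, whose only lattice neighbour outside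
the box is `z`) is a located surgery output at `z` (`GlueGeom.exists_surgery_rect`,
`SlabGluingFact2Boxes.lean`). [cite: DuminilCopinSidoraviciusTassion2016, §2.3, proof of Fact 2 (construction of ω^{(z)})] -/
theorem exists_surgOut_src_box (hG : G.InRange) (hk : 0 < k) (hω : ω ⊆ (slabGraph 3 k).edgeSet)
    (hX : ω ∈ G.evX k) {z : ℤ × ℤ} (hzs : z ∈ G.small) (hz1 : z.1 = G.n) (hu : G.u₃ = G.n)
    (hz2 : z.2 + 1 ≤ G.n) (hzl : z ∉ G.lastBad k ω) (haγ : (z.1 + 1, z.2) ∈ G.γcols k ω)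
    {x₀ s' : slab 3 k} (hx₀1 : (planar k x₀).1 = z.1 + 1) (hx₀2 : |(planar k x₀).2 - z.2| ≤ 1)
    (hs' : s' ∈ slabLift k G.src')
    (hπ : ω ∈ openConnIn (slabLift k G.small ∩ {v | planar k v ∉ G.γcols k ω}) x₀ s') :
    ∃ ω', G.SurgOut k 3 ω z ω' := by
  obtain ⟨hn, hu₃, hu₁, hα, hαn, hy0, hy⟩ := id hG
  have hzs' := hzs
  simp only [small, sqBox, Set.mem_setOf_eq, abs_le] at hzs'
  rw [abs_le] at hx₀2
  -- the box `[n+1, n+3] × [z₂-3, z₂+3]`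
  have hbig : boxR (z.1 + 1) (z.1 + 3) (z.2 - 3) (z.2 + 3) ⊆ G.big := by
    intro q hq
    rw [mem_boxR_iff] at hq
    simp only [big, sqBox, Set.mem_setOf_eq, abs_le, Prod.fst_zero, Prod.snd_zero, sub_zero]
    omega
  have hsq : boxR (z.1 + 1) (z.1 + 3) (z.2 - 3) (z.2 + 3) ⊆ sqBox z 3 := by
    intro q hq
    rw [mem_boxR_iff] at hq
    simp only [sqBox, Set.mem_setOf_eq, abs_le, Nat.cast_ofNat]
    omega
  have hZ : ∀ q ∈ boxR (z.1 + 1) (z.1 + 3) (z.2 - 3) (z.2 + 3), q ∉ G.zSeg := by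
    intro q hq hqZ
    rw [mem_boxR_iff] at hq
    simp only [zSeg, sideSeg, Set.mem_setOf_eq] at hqZ
    omega
  have hsrc : ∀ q ∈ boxR (z.1 + 1) (z.1 + 3) (z.2 - 3) (z.2 + 3), q ∉ G.src := by
    intro q hq hqs
    rw [mem_boxR_iff] at hq
    simp only [src, sqBox, Set.mem_setOf_eq, abs_le, Prod.fst_zero, Prod.snd_zero, sub_zero] at hqs
    omega
  have hnbr : ∃ q₀ : ℤ × ℤ, ∀ q, planarAdj (z.1 + 1, z.2) q → q ∈ G.big →
      q ∉ boxR (z.1 + 1) (z.1 + 3) (z.2 - 3) (z.2 + 3) → q = q₀ := by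
    refine ⟨z, fun q hadj _ hqD => ?_⟩
    rw [mem_boxR_iff] at hqD
    rw [planarAdj_iff_coord] at hadj
    simp only at hadj
    refine Prod.ext ?_ ?_ <;> omega
  have hrect := exists_surgery_rect (G := G) hk hω hX (xL := z.1 + 1) (xR' := z.1 + 3)
    (xR := z.1 + 3) (rB := z.2 - 3) (rP := z.2 + 3) (rT := z.2 + 3) (by omega) le_rfl (by omega) le_rfl
    (fun q hq => Or.inl (hbig hq)) hsrc hbig hZ (fun q hq _ _ => hq)
    (z := (z.1 + 1, z.2)) (by rw [mem_boxR_iff]; simp only; omega) haγ hnbr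
    (fun v hv hvD => hzl ⟨v, hv, mem_sqBox_comm (hsq hvD)⟩)
    (x₀ := x₀) (by rw [mem_boxR_iff]; omega) hs' hπ
  obtain ⟨sg, hsg⟩ := hrect
  exact ⟨_, sg.surgOut hX (hsg ▸ hsq)⟩

/-- PROVED — **the connector through the right-hand neighbour column at a point of `U(ω)` over
`S_{3n}`.** For `ω ∈ 𝒳` a lattice configuration and `z = (n, z₂)`, a column of `γ_min(ω)`, with
`u_{3n} = n`, `z₂ ≤ n - 1`: if the column `a = z + (1,0)` is off `γ_min(ω)` and a (P2)-witness path
starts over a diagonal column `d = (n+1, z₂ ± 1)`, the connector surgery of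
`SlabGluingFact2Connector.lean` attached at the last vertex `g` of `γ_min(ω)` over `z`, along the
corridor "over `a` from the height of `g` to that of the last witness vertex `w'` over `d`, then `w'`",
is a located surgery output at `z`. DST's order condition holds because the successor of `g` on
`γ_min(ω)` is a lattice neighbour of `g` at the same height over a column of `γ_min(ω)` other than
that of `z`, hence to the left of `a`. [cite: DuminilCopinSidoraviciusTassion2016, §2.3, proof of Fact 2 (pp. 6–7)] -/
theorem exists_surgOut_src_corridor (hG : G.InRange) (hω : ω ⊆ (slabGraph 3 k).edgeSet)
    (hX : ω ∈ G.evX k) {z : ℤ × ℤ} (hzs : z ∈ G.small) (hz1 : z.1 = G.n) (hu : G.u₃ = G.n)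
    (hzγ : z ∈ G.γcols k ω) (haγ : (z.1 + 1, z.2) ∉ G.γcols k ω)
    {x₀ s' : slab 3 k} (hx₀1 : (planar k x₀).1 = z.1 + 1)
    (hx₀2 : (planar k x₀).2 = z.2 + 1 ∨ (planar k x₀).2 = z.2 - 1)
    (hs' : s' ∈ slabLift k G.src')
    (hπ : ω ∈ openConnIn (slabLift k G.small ∩ {v | planar k v ∉ G.γcols k ω}) x₀ s') :
    ∃ ω', G.SurgOut k 3 ω z ω' := by
  obtain ⟨hn, hu₃, hu₁, hα, hαn, hy0, hy⟩ := id hG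
  have hA : ω ∈ G.evA k := hX.1.1.1
  obtain ⟨hγO, -⟩ := G.γmin_spec k hA
  set γ := G.γmin k ω with hγdef
  have hzs' := hzs
  simp only [small, sqBox, Set.mem_setOf_eq, abs_le] at hzs'
  set a : ℤ × ℤ := (z.1 + 1, z.2) with ha
  set d : ℤ × ℤ := planar k x₀ with hd
  have ha1 : a.1 = z.1 + 1 := rfl
  have ha2 : a.2 = z.2 := rfl
  have hd2 : d.2 ≠ z.2 := by rcases hx₀2 with h' | h' <;> omega
  have hda : d ≠ a := fun h => hd2 (by rw [h])
  have hza : z ≠ a := fun h => by have := congrArg Prod.fst h; omega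
  have hzd : z ≠ d := fun h => by have := congrArg Prod.fst h; omega
  have hadj_za : planarAdj z a := (planarAdj_iff_coord z a).2 (Or.inl ⟨ha1, ha2⟩)
  have hadj_ad : planarAdj a d := by
    rw [planarAdj_iff_coord]
    rcases hx₀2 with h' | h'
    · exact Or.inr (Or.inr (Or.inl ⟨by omega, by omega⟩))
    · exact Or.inr (Or.inr (Or.inr ⟨by omega, by omega⟩))
  -- regions of the columns `a` and `d`
  have has : a ∈ G.small := by
    simp only [small, sqBox, Set.mem_setOf_eq, abs_le, ha1, ha2]; omega
  have hcol : ∀ q : ℤ × ℤ, q.1 = z.1 + 1 → q ∉ G.src ∧ q ∉ G.src' := by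
    intro q hq1
    refine ⟨?_, ?_⟩
    · simp only [src, sqBox, Set.mem_setOf_eq, abs_le, Prod.fst_zero, Prod.snd_zero, sub_zero, not_and]
      intro h; omega
    · simp only [src', sqBox, Set.mem_setOf_eq, abs_le, not_and]
      intro h; omega
  obtain ⟨hasrc, hasrc'⟩ := hcol a ha1
  obtain ⟨hdsrc, hdsrc'⟩ := hcol d hx₀1
  -- `g`: the last vertex of `γ` over `z`
  obtain ⟨g₀, hg₀γ, hg₀z⟩ := hzγ
  obtain ⟨pre, g, post, hγeq, hgz, hpostz⟩ :=
    exists_last_split (p := fun x => planar k x = z) γ ⟨g₀, hg₀γ, hg₀z⟩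
  have hgγ : g ∈ γ := by rw [hγeq]; simp
  -- the witness path and its last vertex `w'` over `d`
  obtain ⟨π, hπO⟩ := exists_isOSAP_of_openConnIn hπ
  have hx₀π : x₀ ∈ π := by
    have := hπO.head_mem hπO.ne_nil
    rw [Set.mem_singleton_iff] at this
    rw [← this]; exact List.head_mem _
  obtain ⟨πpre, w', sgt, hπeq, hw'd, -⟩ :=
    exists_last_split (p := fun x => planar k x = d) π ⟨x₀, hx₀π, rfl⟩
  have hw'π : w' ∈ π := by rw [hπeq]; simp
  have hw'S := hπO.subset w' hw'π
  -- the corridor: over `a` from the height of `g` to that of `w'`, then `w'`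
  have hhg : ht g ≤ k := ht_le g
  have hhw : ht w' ≤ k := ht_le w'
  have hV := vline_spath (k := k) a hhg hhw
  have hmemV : ∀ v ∈ vline k a (ht g) (ht w'), planar k v = a := fun v hv =>
    ((mem_vline_iff hhg hhw v).1 hv).1
  have hVw' : (slabGraph 3 k).Adj (vtx k a (ht w')) w' := by
    have := vtx_adj_vtx_planar (k := k) hadj_ad (ht w')
    rwa [← hw'd, vtx_planar_ht] at this
  have hC := hV.concat hVw' (fun h => hda (by rw [← hw'd, hmemV w' h]))
  set C := vline k a (ht g) (ht w') ++ [w'] with hCdef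
  have hmemC : ∀ v ∈ C, planar k v = a ∨ v = w' := by
    intro v hv
    rcases List.mem_append.1 hv with h | h
    · exact Or.inl (hmemV v h)
    · exact Or.inr (List.mem_singleton.1 h)
  have hgV : (slabGraph 3 k).Adj g (vtx k a (ht g)) := by
    have := vtx_adj_vtx_planar (k := k) hadj_za (ht g)
    rwa [← hgz, vtx_planar_ht] at this
  have hgC := hC.cons hgV (fun h => by
    rcases hmemC g h with h | h
    · exact hza (by rw [← hgz, h])
    · exact hzd (by rw [← hgz, h, hw'd]))
  have hCne : C ≠ [] := by simp [hCdef]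
  have hChead : C.head hCne = vtx k a (ht g) := by
    have h1 := hC.head
    rw [List.head?_eq_some_head hCne, Option.some.injEq] at h1
    exact h1
  -- the connector
  have hcn := G.exists_connector_of_corridor_at hω hX hgγ hCne hgC.chain hgC.nodup
    ?_ ?_ ?_ ?_ ?_ hs' hπO ⟨w', by simp [hCdef], hw'π⟩
  · obtain ⟨cn, hcng, hcnI⟩ := hcn
    have hg3 : planar k cn.g ∈ sqBox z 3 := by
      rw [hcng, hgz]; simp [sqBox]
    have hIr : ∀ x ∈ cn.I, planar k x ∈ sqBox z 3 := fun x hx => by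
      simp only [sqBox, Set.mem_setOf_eq, abs_le, Nat.cast_ofNat]
      rcases hmemC x (hcnI x hx) with h | h
      · rw [h, ha1, ha2]; omega
      · rw [h, hw'd]
        rcases hx₀2 with h' | h' <;> omega
    exact ⟨_, cn.surgOut hX hg3 hIr⟩
  · -- off `γ_min`
    intro v hv hvγ
    rcases hmemC v hv with h | h
    · exact haγ ⟨v, hvγ, h⟩
    · exact hw'S.2 ⟨v, hvγ, by rw [h]⟩
  · -- inside the window
    intro v hv
    rw [mem_slabLift_iff]
    rcases hmemC v hv with h | h
    · rw [h]; exact Or.inr has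
    · rw [h]; exact Or.inr hw'S.1
  · -- off `S̄_{3n}`
    intro v hv h'
    rw [mem_slabLift_iff] at h'
    rcases hmemC v hv with h | h
    · exact hasrc (h ▸ h')
    · exact hdsrc (by rw [h, hw'd] at h'; exact h')
  · -- off `S̄'_n`
    intro v hv h'
    rw [mem_slabLift_iff] at h'
    rcases hmemC v hv with h | h
    · exact hasrc' (h ▸ h')
    · exact hdsrc' (by rw [h, hw'd] at h'; exact h')
  · -- DST's order condition: the successor of `g` lies to the left of `a`, at the height of `g`
    intro l₁ l₂ y hγy
    rw [hChead]
    change γ = l₁ ++ g :: y :: l₂ at hγy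
    -- `y` is the successor of `g`, hence in `post`, hence off the column of `z`
    have hypost : y ∈ post := by
      cases hp : post with
      | nil =>
        exfalso
        rw [hp] at hγeq
        have hnd := hγO.nodup
        have hlast : γ.getLast hγO.ne_nil = g := by
          rw [List.getLast_congr _ (by simp) hγeq]; simp
        have hlast' : γ.getLast hγO.ne_nil ∈ y :: l₂ := by
          rw [List.getLast_congr _ (by simp) hγy, List.getLast_append_of_ne_nil _ (by simp),
            List.getLast_cons (by simp)]
          exact List.getLast_mem _
        rw [hlast] at hlast'
        rw [hγy] at hnd
        exact (List.nodup_cons.1 (List.nodup_append.1 hnd).2.1).1 hlast'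
      | cons y₀ r =>
        rw [hp] at hγeq
        have := eq_of_cons_cons_eq_append hγO.nodup hγeq hγy
        rw [this]; exact List.mem_cons_self
    have hyz : planar k y ≠ z := hpostz y hypost
    have hyγ : y ∈ γ := by rw [hγy]; simp
    have hya : planar k y ≠ a := fun h => haγ ⟨y, hyγ, h⟩
    have hedge : s(g, y) ∈ ω := by
      have hch := hγO.chain
      rw [hγy, List.isChain_append] at hch
      exact (List.isChain_cons_cons.1 hch.2.1).1.1
    have hadj := (slab_adj_iff _ _).1 ((SimpleGraph.mem_edgeSet _).1 (hω hedge))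
    rw [hgz] at hadj
    rcases hadj with ⟨hh, hp⟩ | ⟨hp, -⟩
    · refine vKey_lt_of_fst_lt (by rw [← hh, ht_vtx hhg]) ?_
      rw [planar_vtx, ha1]
      rw [planarAdj_iff_coord] at hp
      have hya' : (planar k y).1 = z.1 + 1 → (planar k y).2 ≠ z.2 := fun h1 h2 =>
        hya (Prod.ext (h1.trans ha1.symm) (h2.trans ha2.symm))
      omega
    · exact absurd hp.symm hyz

end OverSrc


/-- PROVED — **a located surgery at every point of `U(ω)` over `S_{3n}`** off the end of `γ_min(ω)`
and off the corner `srcCorner` (DST 2016, §2.3, proof of Fact 2, the construction of `ω^{(z)}`, at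
the points where the ball `B_R(z)` would meet `S_{3n}`, a case on which the printed proof is silent):
such a point is `z = (n, z₂)` with `u_{3n} = n` and `z₂ ≤ n - 1`, and its (P2)-witness starts over
the column `x = n + 1` within one row of `z` (a start over `S_{3n}` would give `C`). Three cases:
the right-hand neighbour column `a = z + (1,0)` is a column of `γ_min(ω)` — the cleared box to the
right (`exists_surgOut_src_box`); `a` is off `γ_min(ω)` and the witness starts over `a` — then
`z ∈ U'(ω)` and the graft of `SlabGluingLemma6.lean` applies (`GlueGeom.exists_surgOut_of_goodU'`);
`a` is off `γ_min(ω)` and the witness starts over a diagonal column — the connector through `a`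
(`exists_surgOut_src_corridor`). [cite: DuminilCopinSidoraviciusTassion2016, §2.3, proof of Fact 2 (pp. 6–7)] -/
theorem exists_surgOut_src (hG : G.InRange) (hk : 0 < k) (hω : ω ⊆ (slabGraph 3 k).edgeSet)
    (hX : ω ∈ G.evX k) {z : ℤ × ℤ} (hz : z ∈ G.U k ω) (hzsrc : z ∈ G.src)
    (hzl : z ∉ G.lastBad k ω) (hzb : z ∉ G.zBad) (hzc : z ∉ G.srcCorner) :
    ∃ ω', G.SurgOut k 3 ω z ω' := by
  obtain ⟨hn, hu₃, hu₁, hα, hαn, hy0, hy⟩ := id hG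
  obtain ⟨hzs, hzγ, x₀, hx₀, s', hs', hπ⟩ := id hz
  have hx₀S : x₀ ∈ slabLift k G.small ∩ {v | planar k v ∉ G.γcols k ω} := hπ.1
  have hx₀src : planar k x₀ ∉ G.src := fun h => hX.2 ⟨x₀, h, s', hs',
    openConnIn_mono (fun v hv => slabLift_mono k Set.subset_union_right hv.1) _ _ hπ⟩
  -- coordinates
  have hzs' := hzs
  have hzsrc' := hzsrc
  have hx₀s : planar k x₀ ∈ G.small := hx₀S.1
  simp only [small, src, sqBox, Set.mem_setOf_eq, abs_le, Prod.fst_zero, Prod.snd_zero, sub_zero,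
    not_and, not_le, Nat.cast_one] at hzs' hzsrc' hx₀s hx₀src hx₀
  simp only [srcCorner, Set.mem_setOf_eq, not_and, not_le] at hzc
  have hz1 : z.1 = G.n := by omega
  have hu : G.u₃ = G.n := by omega
  have hz2 : z.2 + 1 ≤ G.n := by omega
  have hx₀1 : (planar k x₀).1 = z.1 + 1 := by omega
  have hx₀2 : |(planar k x₀).2 - z.2| ≤ 1 := by rw [abs_le]; omega
  by_cases haγ : (z.1 + 1, z.2) ∈ G.γcols k ω
  · exact exists_surgOut_src_box hG hk hω hX hzs hz1 hu hz2 hzl haγ hx₀1 hx₀2 hs' hπ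
  · by_cases hj : (planar k x₀).2 = z.2
    · -- the witness starts over `a`: `z ∈ U'(ω)`, the graft applies
      have hU' : z ∈ G.U' k ω :=
        ⟨hzs, hzγ, x₀, (planarAdj_iff_coord _ _).2 (Or.inr (Or.inl ⟨by omega, hj.symm⟩)), s', hs', hπ⟩
      refine exists_surgOut_of_goodU' hG hk hω hX ⟨hU', fun h => ?_⟩
      rcases h with (h | h) | h
      · exact hzb h
      · exact hzl h
      · simp only [srcCorner, Set.mem_setOf_eq] at h; omega
    · exact exists_surgOut_src_corridor hG hω hX hzs hz1 hu hzγ haγ hx₀1 (by omega) hs' hπ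

/-! ## Located surgeries at the points of `U(ω)` off `S_{3n}`: the clipped box -/

section OffSrc

variable {z : ℤ × ℤ}

/-- **The start of a (P2)-witness of `U(ω)` lies in the clipped box**: a point of `z + B_1` inside
`B'_n` and off `S_{3n}` lies in `D^c(z)` (off the excluded corner; the sup-norm form of
`GlueGeom.mem_cDbox_of_adj`). [folklore] -/
theorem mem_cDbox_of_sqBox_one (hG : G.InRange) (hzs : z ∈ G.small) (hzc : z ∉ G.srcCorner)
    {q : ℤ × ℤ} (hq : q ∈ sqBox z 1) (hqs : q ∈ G.small) (hqsrc : q ∉ G.src) : q ∈ G.cDbox z := by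
  obtain ⟨hn, hu₃, hu₁, hα, hαn, hy0, hy⟩ := hG
  simp only [small, src, sqBox, Set.mem_setOf_eq, abs_le, Prod.fst_zero, Prod.snd_zero, sub_zero,
    not_and, not_le, Nat.cast_one] at hzs hqs hqsrc hq
  simp only [srcCorner, Set.mem_setOf_eq, not_and, not_le] at hzc
  simp only [cDbox, mem_boxR_iff, cbxL, bxR, brB, brT]
  split_ifs <;> omega

/-- PROVED — **located surgery with the clipped box at every point of `U(ω)` off `S_{3n}`**, off
`lastBad`, `zBad`, `srcCorner`, in the full range `u_{3n} ≤ n` (as `GlueGeom.exists_surgOut_cDbox` of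
`SlabGluingLemma6.lean`, for the sup-norm witnesses of `U(ω)` rather than the lattice-neighbour
witnesses of `U'(ω)`: the rectangle case `GlueGeom.exists_surgery_rect` applied to `D^c(z) ⊆ z + B_3`,
which never meets `S_{3n}` and contains the start of the witness). [cite: DuminilCopinSidoraviciusTassion2016, §2.3, proof of Fact 2 (construction of ω^{(z)})] -/
theorem exists_surgOut_cDbox_U (hG : G.InRange) (hk : 0 < k)
    {ω : BondConfig (slab 3 k)} (hω : ω ⊆ (slabGraph 3 k).edgeSet) (hX : ω ∈ G.evX k)
    (hz : z ∈ G.U k ω) (hzsrc : z ∉ G.src) (hzl : z ∉ G.lastBad k ω) (hzb : z ∉ G.zBad)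
    (hzc : z ∉ G.srcCorner) : ∃ ω', G.SurgOut k 3 ω z ω' := by
  have hA : ω ∈ G.evA k := hX.1.1.1
  obtain ⟨hγO, -⟩ := G.γmin_spec k hA
  obtain ⟨hzs, hzγ, x₀, hx₀, s', hs', hπ⟩ := hz
  have hzbig : z ∈ G.big := by
    obtain ⟨g, hgγ, hgz⟩ := hzγ
    rw [← hgz]; exact hγO.subset g hgγ
  have hx₀S : x₀ ∈ slabLift k G.small ∩ {v | planar k v ∉ G.γcols k ω} := hπ.1
  have hx₀src : planar k x₀ ∉ G.src := fun h => hX.2 ⟨x₀, h, s', hs',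
    openConnIn_mono (fun v hv => slabLift_mono k Set.subset_union_right hv.1) _ _ hπ⟩
  obtain ⟨hf1, hf2, hf3, hf4⟩ := cbox_frame hG hzbig hzs
  obtain ⟨sg, hsg⟩ := exists_surgery_rect (G := G) hk hω hX hf1 hf2 hf3 hf4
    (cDbox_subset_region hG hzbig hzs) (fun q hq => cDbox_not_src hq) (cRPbox_subset_big hG hzbig hzs)
    (fun q hq => cRPbox_not_zSeg hG hzbig hzb hq) (fun q hq hqb hqZ => mem_cRPbox_of hG hq hqb hqZ)
    (mem_cDbox_self hG hzbig hzs hzsrc hzc) hzγ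
    ⟨_, fun q h1 h2 h3 => nbr_eq_of_not_cDbox hG hzbig hzs hzsrc hzc h1 h2 h3⟩
    (getLast_not_cDbox hzl) (mem_cDbox_of_sqBox_one hG hzs hzc hx₀ hx₀S.1 hx₀src) hs' hπ
  exact ⟨_, sg.surgOut hX (hsg ▸ cDbox_subset_sqBox)⟩

end OffSrc

/-! ## The good points of `U(ω)` and Fact 2 in the rate form, full range -/

/-- The good points of `U(ω)` in the full range — off the three excluded bounded sets `zBad` (near
the ends of `Z_n`), `lastBad` (near the end of `γ_min(ω)`), `srcCorner` (near the corner
`(n, u_{3n})`) — form a finite set. [folklore] -/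
theorem goodUfull_finite (G : GlueGeom) (ω : BondConfig (slab 3 k)) :
    (G.U k ω \ (G.zBad ∪ G.lastBad k ω ∪ G.srcCorner)).Finite :=
  (G.U_finite k ω).subset Set.sdiff_subset

/-- PROVED — **a recoverable located surgery (radius `3`) exists at every good point of `U(ω)`**,
for `ω ∈ 𝒳` a lattice configuration, in the full range `u_{3n} ≤ n` of the Gluing Lemma: over
`S_{3n}` by `exists_surgOut_src`, elsewhere by the clipped box (`exists_surgOut_cDbox_U`).
[cite: DuminilCopinSidoraviciusTassion2016, §2.3, proof of Fact 2 (construction of ω^{(z)})] -/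
theorem exists_surgOut_of_goodUfull (hG : G.InRange) (hk : 0 < k) (hω : ω ⊆ (slabGraph 3 k).edgeSet)
    (hX : ω ∈ G.evX k) {z : ℤ × ℤ} (hz : z ∈ G.U k ω \ (G.zBad ∪ G.lastBad k ω ∪ G.srcCorner)) :
    ∃ ω', G.SurgOut k 3 ω z ω' := by
  obtain ⟨hzU, hzbad⟩ := hz
  simp only [Set.mem_union, not_or] at hzbad
  obtain ⟨⟨hzb, hzl⟩, hzc⟩ := hzbad
  by_cases hzsrc : z ∈ G.src
  · exact exists_surgOut_src hG hk hω hX hzU hzsrc hzl hzb hzc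
  · exact exists_surgOut_cDbox_U hG hk hω hX hzU hzsrc hzl hzb hzc

/-- On any configuration, at least `|U(ω)| - 105` points of `U(ω)` are good. [folklore] -/
theorem ncard_U_le_goodUfull (G : GlueGeom) (ω : BondConfig (slab 3 k)) :
    (G.U k ω).ncard ≤ (G.goodUfull_finite ω).toFinset.card + 105 := by
  classical
  have hU := G.U_finite k ω
  have hsplit : G.U k ω ⊆ G.U k ω \ (G.zBad ∪ G.lastBad k ω ∪ G.srcCorner) ∪
      (G.U k ω ∩ G.zBad ∪ G.U k ω ∩ G.lastBad k ω ∪ G.U k ω ∩ G.srcCorner) := by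
    intro z hz
    by_cases h : z ∈ G.zBad ∪ G.lastBad k ω ∪ G.srcCorner
    · rcases h with (h | h) | h
      · exact Or.inr (Or.inl (Or.inl ⟨hz, h⟩))
      · exact Or.inr (Or.inl (Or.inr ⟨hz, h⟩))
      · exact Or.inr (Or.inr ⟨hz, h⟩)
    · exact Or.inl ⟨hz, h⟩
  have h1 := G.ncard_inter_zBad_le (G.U k ω)
  have h2 := G.ncard_inter_lastBad_le ω (G.U k ω)
  have h3 := G.ncard_inter_srcCorner_le (G.U k ω)
  have hfin : (G.U k ω \ (G.zBad ∪ G.lastBad k ω ∪ G.srcCorner) ∪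
      (G.U k ω ∩ G.zBad ∪ G.U k ω ∩ G.lastBad k ω ∪ G.U k ω ∩ G.srcCorner)).Finite :=
    (G.goodUfull_finite ω).union (((hU.inter_of_left _).union (hU.inter_of_left _)).union
      (hU.inter_of_left _))
  calc (G.U k ω).ncard
      ≤ (G.U k ω \ (G.zBad ∪ G.lastBad k ω ∪ G.srcCorner) ∪
          (G.U k ω ∩ G.zBad ∪ G.U k ω ∩ G.lastBad k ω ∪ G.U k ω ∩ G.srcCorner)).ncard :=
        Set.ncard_le_ncard hsplit hfin
    _ ≤ (G.U k ω \ (G.zBad ∪ G.lastBad k ω ∪ G.srcCorner)).ncard +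
          (G.U k ω ∩ G.zBad ∪ G.U k ω ∩ G.lastBad k ω ∪ G.U k ω ∩ G.srcCorner).ncard :=
        Set.ncard_union_le _ _
    _ ≤ (G.U k ω \ (G.zBad ∪ G.lastBad k ω ∪ G.srcCorner)).ncard +
          ((G.U k ω ∩ G.zBad ∪ G.U k ω ∩ G.lastBad k ω).ncard +
          (G.U k ω ∩ G.srcCorner).ncard) := by
        gcongr; exact Set.ncard_union_le _ _
    _ ≤ (G.U k ω \ (G.zBad ∪ G.lastBad k ω ∪ G.srcCorner)).ncard +
          (((G.U k ω ∩ G.zBad).ncard + (G.U k ω ∩ G.lastBad k ω).ncard) +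
          (G.U k ω ∩ G.srcCorner).ncard) := by
        gcongr; exact Set.ncard_union_le _ _
    _ ≤ (G.goodUfull_finite ω).toFinset.card + 105 := by
        rw [Set.ncard_eq_toFinset_card _ (G.goodUfull_finite ω)]; omega

/-- PROVED — **hypothesis (H1) of `SlabGluingFact2Reduction.lean` in the full range**: for `ω ∈ 𝒳`
a lattice configuration, located surgeries (radius `3`) exist at all but at most `105` points of
`U(ω)`. [cite: DuminilCopinSidoraviciusTassion2016, §2.3, proof of Fact 2] -/
theorem exists_goodUfull_family (hG : G.InRange) (hk : 0 < k)
    (hω : ω ⊆ (slabGraph 3 k).edgeSet) (hX : ω ∈ G.evX k) :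
    ∃ Good : Finset (ℤ × ℤ), (↑Good : Set (ℤ × ℤ)) ⊆ G.U k ω ∧ (G.U k ω).ncard ≤ Good.card + 105 ∧
      ∀ z ∈ Good, ∃ ω', G.SurgOut k 3 ω z ω' := by
  refine ⟨(G.goodUfull_finite ω).toFinset, fun z hz => ?_, G.ncard_U_le_goodUfull ω, fun z hz => ?_⟩
  · exact ((Set.Finite.mem_toFinset _).1 hz).1
  · exact exists_surgOut_of_goodUfull hG hk hω hX ((Set.Finite.mem_toFinset _).1 hz)

end GlueGeom

/-! ## Fact 2 -/

section Fact2

open GlueGeom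

/-- PROVED — **DST 2016, §2.3, Fact 2 in the rate form, full range**: for `0 < k`, `0 < p < 1`,
`P[𝒳 ∩ {|U| ≥ t}] ≤ (K/t) · P[S_{3n} ⟷^{B_{3n} ∪ B'_n} S'_n]` for all `t ≥ 210`, uniformly over
`GlueGeom.InRange` (`u_{3n} ≤ n` included), with `K = 338 λ^{169(5k+4)}`, `λ = 2/min{p, 1-p}` — the
display at the end of the printed proof (p. 7). Lemma 7 for a `7`-separated family of located
surgeries (`GlueGeom.real_evX_ncard_le`, `SlabGluingFact2Reduction.lean`) at the good points of
`U(ω)` (`GlueGeom.exists_goodUfull_family`). [cite: DuminilCopinSidoraviciusTassion2016, §2.3 (Fact 2 and its proof, pp. 6–7)] -/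
theorem fact2_rate_full (k : ℕ) (hk : 0 < k) (p : unitInterval) (hp0 : 0 < (p : ℝ)) (hp1 : (p : ℝ) < 1) :
    ∀ t : ℕ, 210 ≤ t → ∀ G : GlueGeom, G.InRange →
      (bondPercolation (slabGraph 3 k) p).real (G.evX k ∩ {ω | t ≤ (G.U k ω).ncard}) ≤
        (338 * (2 / min (p : ℝ) (1 - p)) ^ ((5 * k + 4) * (2 * (3 + 3) + 1) ^ 2)) / t *
          (bondPercolation (slabGraph 3 k) p).real (G.evC k) := by
  intro t ht G hG
  exact G.real_evX_ncard_le k p hp0 hp1 3 105 (fun ω hω hX => G.exists_goodUfull_family hG hk hω hX)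
    (by omega) (by omega)

/-- PROVED — **Duminil-Copin–Sidoravicius–Tassion 2016, §2.3, Fact 2**, the named fact
`DuminilCopinSidoraviciusTassion2016_fact2` of `SlabGluing.lean` DISCHARGED: for `0 < k`, `0 < p < 1`
and `ε > 0`, for all `t` large enough, `P[𝒳 ∩ {|U| ≥ t}] ≤ ε · P[S_{3n} ⟷^{B_{3n} ∪ B'_n} S'_n]`
uniformly over the geometric data in the range of Lemma 6. Proof as printed (pp. 6–7): the
multi-valued map principle (Lemma 7) applied to the local surgeries `ω ↦ {ω^{(z)} : z ∈ U(ω)}` gives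
the rate form `≤ (K/t) P[C]` (`fact2_rate_full`; in the range `u_{3n} + 1 ≤ n` this is the rerouting
surgery in the cleared box `D(z)` of `SlabGluingRouting.lean`; in the boundary case `u_{3n} = n`, on
which the printed proof is silent, the box is clipped off `S_{3n}`, and at the points over `S_{3n}`
the graft, the box to the right, or the connector through the right-hand column is used), and
"choosing `t` large enough concludes the proof" (`…_fact2_bound_of_rate`).
[cite: DuminilCopinSidoraviciusTassion2016, §2.3 (Fact 2, pp. 6–7)] [cite: NewmanTassionWu2017, §3.2 (proof of Thm. 3.9, Fact 2)] -/
theorem DuminilCopinSidoraviciusTassion2016_fact2_holds : DuminilCopinSidoraviciusTassion2016_fact2 := by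
  intro k hk p hp0 hp1
  exact DuminilCopinSidoraviciusTassion2016_fact2_bound_of_rate 210
    ⟨_, fun t ht G hG => fact2_rate_full k hk p hp0 hp1 t ht G hG⟩

end Fact2

end Literature.Probability.Percolation

end
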